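import Mathlib.InformationTheory.KullbackLeibler.Basic
import Mathlib.Probability.Kernel.CompProdEqIff
import Mathlib.Probability.Kernel.Composition.IntegralCompProd
import Mathlib.Probability.Kernel.Disintegration.StandardBorel
import Literature.Probability.Divergences.DonskerVaradhan
import Literature.MathematicalPhysics.KineticTheory.HardSphereEuler
import HarnessLib

/-!
# The marginal entropy ledger — preliminaries: conditional Donsker–Varadhan for the fibre entropy
# (helper file of stub `stub_marginalEntropyLedger`, line `local-gibbs-entropy-ledger`,
# crux `KineticCurrentsWindowLDUniform`, stmt-AtomisticToContinuum-14662)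

Pure measure theory around Mathlib's `InformationTheory.klDiv`, used by S3 (the marginal entropy
ledger) to convert an entropy budget against a Markov kernel into a bound on the integrated fibre
entropy of a disintegrated law:

* `mel_lintegral_klDiv_le_klDiv_compProd` — the integral form of the conditional relative entropy
  is dominated by its composition-product form: for a finite measure `μ` and finite kernels `κ, η`
  (countably generated target), `∫⁻ x, KL(κ x ‖ η x) dμ ≤ KL(μ ⊗ₘ κ ‖ μ ⊗ₘ η)` (equality in the
  absolutely continuous case; Mathlib's `KullbackLeibler/ChainRule` leaves the integral form as a
  TODO). Proof: `μ ⊗ₘ κ = (μ ⊗ₘ η).withDensity ρ` for the jointly measurable kernel density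
  `ρ = ∂κ/∂η` (`Kernel.rnDeriv`, `Measure.compProd_withDensity`), so both sides are
  `∫∫ klFun ρ dη dμ`.
* `mel_klDiv_compProd_le_of_forall` — the conditional Donsker–Varadhan bound with a Markov KERNEL
  reference (the constant-kernel case is `Literature.Probability.Divergences.klDiv_fst_prod_le_of_forall`):
  if `∫ g dL ≤ K` for every bounded measurable `g` normalised on every fibre,
  `∫ e^{g(x,·)} d(κ x) = 1`, then `KL(L ‖ L.fst ⊗ₘ κ) ≤ K`.
* `stub_marginalEntropyLedger_prelim` (registered helper stub) — consequently, on `𝕋³ × ℝ³`,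
  `∫⁻ x, KL(L(·|x) ‖ κ x) L.fst(dx) ≤ K` with the disintegration `L = L.fst ⊗ₘ L.condKernel`.

All statements are folklore (Donsker–Varadhan 1975; Kipnis–Landim 1999, Appendix 1 §8).
-/

noncomputable section

open MeasureTheory Set Filter InformationTheory ProbabilityTheory
open scoped ENNReal Topology

namespace Summit.AtomisticToContinuum.HydrodynamicLimit.Theorems.KineticCurrentsWindowLDUniformLocalGibbs

open Literature.MathematicalPhysics.KineticTheory (T3 V3)

/-! ### The integral form of the conditional relative entropy -/

/-- **Conditional chain-rule inequality.** For a finite measure `μ` and finite kernels `κ, η`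
with countably generated target, the `μ`-integral of the fibre entropies is at most the relative
entropy of the composition products: `∫⁻ x, KL(κ x ‖ η x) dμ ≤ KL(μ ⊗ₘ κ ‖ μ ⊗ₘ η)` (with
equality when `μ ⊗ₘ κ ≪ μ ⊗ₘ η`; otherwise the right side is `∞`). The joint density is the
kernel density: `μ ⊗ₘ κ = (μ ⊗ₘ η).withDensity (∂κ/∂η)`. [folklore] -/
theorem mel_lintegral_klDiv_le_klDiv_compProd {α γ : Type*} [MeasurableSpace α]
    [MeasurableSpace γ] [MeasurableSpace.CountableOrCountablyGenerated α γ] (μ : Measure α)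
    [IsFiniteMeasure μ] (κ η : Kernel α γ) [IsFiniteKernel κ] [IsFiniteKernel η] :
    ∫⁻ x, klDiv (κ x) (η x) ∂μ ≤ klDiv (μ ⊗ₘ κ) (μ ⊗ₘ η) := by
  by_cases hac : μ ⊗ₘ κ ≪ μ ⊗ₘ η
  swap
  · rw [klDiv_of_not_ac hac]
    exact le_top
  have hae : ∀ᵐ x ∂μ, κ x ≪ η x := Measure.absolutelyContinuous_compProd_right_iff.1 hac
  have hρ : Measurable (Function.uncurry (κ.rnDeriv η)) := κ.measurable_rnDeriv η
  -- the joint density is the kernel density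
  have hκ_eq : ∀ᵐ x ∂μ, κ x = η.withDensity (κ.rnDeriv η) x := by
    filter_upwards [hae] with x hx using (Kernel.withDensity_rnDeriv_eq hx).symm
  have hcomp : μ ⊗ₘ κ = (μ ⊗ₘ η).withDensity (fun p => κ.rnDeriv η p.1 p.2) := by
    rw [Measure.compProd_congr hκ_eq, Measure.compProd_withDensity hρ]
  have hrn : (μ ⊗ₘ κ).rnDeriv (μ ⊗ₘ η) =ᵐ[μ ⊗ₘ η] fun p => κ.rnDeriv η p.1 p.2 := by
    rw [hcomp]
    exact Measure.rnDeriv_withDensity _ hρ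
  have hmeas : Measurable fun p : α × γ => ENNReal.ofReal (klFun (κ.rnDeriv η p.1 p.2).toReal) :=
    (measurable_klFun.comp hρ.ennreal_toReal).ennreal_ofReal
  rw [klDiv_eq_lintegral_klFun_of_ac hac]
  refine le_of_eq ?_
  calc ∫⁻ x, klDiv (κ x) (η x) ∂μ
      = ∫⁻ x, ∫⁻ y, ENNReal.ofReal (klFun (κ.rnDeriv η x y).toReal) ∂(η x) ∂μ := by
        refine lintegral_congr_ae ?_
        filter_upwards [hae] with x hx
        rw [klDiv_eq_lintegral_klFun_of_ac hx]
        refine lintegral_congr_ae ?_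
        filter_upwards [Kernel.rnDeriv_eq_rnDeriv_measure (κ := κ) (η := η) (a := x)] with y hy
        rw [hy]
    _ = ∫⁻ p, ENNReal.ofReal (klFun (κ.rnDeriv η p.1 p.2).toReal) ∂(μ ⊗ₘ η) :=
        (Measure.lintegral_compProd hmeas).symm
    _ = ∫⁻ p, ENNReal.ofReal (klFun ((μ ⊗ₘ κ).rnDeriv (μ ⊗ₘ η) p).toReal) ∂(μ ⊗ₘ η) := by
        refine lintegral_congr_ae ?_
        filter_upwards [hrn] with p hp
        rw [hp]

/-! ### Conditional Donsker–Varadhan with a kernel reference -/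

/-- **Conditional Donsker–Varadhan bound, kernel reference.** For a probability law `L` on
`α × β` and a Markov kernel `κ : α → β`: if `∫ g dL ≤ K` for every bounded measurable `g` that
is normalised on every fibre, `∫ e^{g(x,·)} d(κ x) = 1`, then `KL(L ‖ L.fst ⊗ₘ κ) ≤ K`.
Reduction to the unconditional bound `klDiv_le_of_forall_integral_le`: for bounded measurable
`ψ` put `Λ(x) = log ∫ e^{ψ(x,·)} d(κ x)` and `g = ψ - Λ ∘ fst`; then
`∫ ψ dL = ∫ g dL + ∫ Λ dL.fst ≤ K + log ∫ e^Λ dL.fst = K + log ∫ e^ψ d(L.fst ⊗ₘ κ)`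
(Jensen for `exp`, `Measure.integral_compProd`). [folklore] -/
theorem mel_klDiv_compProd_le_of_forall {α β : Type*} [MeasurableSpace α] [MeasurableSpace β]
    {L : Measure (α × β)} [IsProbabilityMeasure L] (κ : Kernel α β) [IsMarkovKernel κ] {K : ℝ}
    (h : ∀ (g : α × β → ℝ) (C : ℝ), Measurable g → (∀ p, |g p| ≤ C) →
      (∀ x, ∫ v, Real.exp (g (x, v)) ∂(κ x) = 1) → ∫ p, g p ∂L ≤ K) :
    klDiv L (L.fst ⊗ₘ κ) ≤ ENNReal.ofReal K := by
  refine Literature.Probability.Divergences.klDiv_le_of_forall_integral_le fun ψ C hψm hψC => ?_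
  have hem : Measurable fun p : α × β => Real.exp (ψ p) := Real.measurable_exp.comp hψm
  have heb : ∀ p, Real.exp (-C) ≤ Real.exp (ψ p) ∧ Real.exp (ψ p) ≤ Real.exp C := fun p =>
    ⟨Real.exp_le_exp.2 ((neg_le_neg (hψC p)).trans (neg_abs_le _)),
      Real.exp_le_exp.2 ((le_abs_self _).trans (hψC p))⟩
  have hexpi : ∀ x, Integrable (fun v => Real.exp (ψ (x, v))) (κ x) := fun x =>
    Integrable.of_bound (hem.comp measurable_prodMk_left).aestronglyMeasurable (Real.exp C)
      (ae_of_all _ fun v => by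
        rw [Real.norm_eq_abs, abs_of_pos (Real.exp_pos _)]
        exact (heb (x, v)).2)
  have hIlo : ∀ x, Real.exp (-C) ≤ ∫ v, Real.exp (ψ (x, v)) ∂(κ x) := fun x => by
    have := integral_mono (integrable_const (Real.exp (-C))) (hexpi x) (fun v => (heb (x, v)).1)
    rwa [integral_const, smul_eq_mul, probReal_univ, one_mul] at this
  have hIhi : ∀ x, ∫ v, Real.exp (ψ (x, v)) ∂(κ x) ≤ Real.exp C := fun x => by
    have := integral_mono (hexpi x) (integrable_const (Real.exp C)) (fun v => (heb (x, v)).2)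
    rwa [integral_const, smul_eq_mul, probReal_univ, one_mul] at this
  have hIpos : ∀ x, 0 < ∫ v, Real.exp (ψ (x, v)) ∂(κ x) := fun x =>
    (Real.exp_pos _).trans_le (hIlo x)
  -- the fibrewise log-partition function `Λ`
  set Λ : α → ℝ := fun x => Real.log (∫ v, Real.exp (ψ (x, v)) ∂(κ x)) with hΛ
  have hΛm : Measurable Λ :=
    Real.measurable_log.comp (hem.stronglyMeasurable.integral_kernel_prod_right' (κ := κ)).measurable
  have hΛb : ∀ x, |Λ x| ≤ C := fun x => abs_le.2
    ⟨by rw [← Real.log_exp (-C)]; exact Real.log_le_log (Real.exp_pos _) (hIlo x),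
      by rw [← Real.log_exp C]; exact Real.log_le_log (hIpos x) (hIhi x)⟩
  -- test function `g = ψ - Λ ∘ fst`, normalised on every fibre
  have hg := h (fun p => ψ p - Λ p.1) (C + C) (hψm.sub (hΛm.comp measurable_fst))
    (fun p => (abs_sub _ _).trans (add_le_add (hψC p) (hΛb p.1))) (fun x => by
      simp only [Real.exp_sub]
      rw [integral_div, Real.exp_log (hIpos x), div_self (hIpos x).ne'])
  have hψi : Integrable ψ L := Integrable.of_bound hψm.aestronglyMeasurable C
    (ae_of_all _ fun p => by rw [Real.norm_eq_abs]; exact hψC p)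
  have hΛi : Integrable (fun p : α × β => Λ p.1) L :=
    Integrable.of_bound (hΛm.comp measurable_fst).aestronglyMeasurable C
      (ae_of_all _ fun p => by rw [Real.norm_eq_abs]; exact hΛb p.1)
  have hsub : ∫ p, ψ p - Λ p.1 ∂L = ∫ p, ψ p ∂L - ∫ p, Λ p.1 ∂L := integral_sub hψi hΛi
  have hfst : ∫ p, Λ p.1 ∂L = ∫ x, Λ x ∂L.fst := by
    rw [Measure.fst, integral_map measurable_fst.aemeasurable hΛm.aestronglyMeasurable]
  -- Jensen: `∫ Λ dL₁ ≤ log ∫ e^Λ dL₁ = log ∫ e^ψ d(L₁ ⊗ κ)`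
  have hΛi' : Integrable Λ L.fst := Integrable.of_bound hΛm.aestronglyMeasurable C
    (ae_of_all _ fun x => by rw [Real.norm_eq_abs]; exact hΛb x)
  have heΛi : Integrable (fun x => Real.exp (Λ x)) L.fst :=
    Integrable.of_bound (Real.measurable_exp.comp hΛm).aestronglyMeasurable (Real.exp C)
      (ae_of_all _ fun x => by
        rw [Real.norm_eq_abs, abs_of_pos (Real.exp_pos _)]
        exact Real.exp_le_exp.2 ((le_abs_self _).trans (hΛb x)))
  have hJ := ConvexOn.map_integral_le convexOn_exp Real.continuous_exp.continuousOn isClosed_univ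
    (ae_of_all _ fun x => mem_univ (Λ x)) hΛi' heΛi
  have hJ' : ∫ x, Λ x ∂L.fst ≤ Real.log (∫ x, Real.exp (Λ x) ∂L.fst) := by
    rw [← Real.log_exp (∫ x, Λ x ∂L.fst)]
    exact Real.log_le_log (Real.exp_pos _) hJ
  have hprod : ∫ p, Real.exp (ψ p) ∂(L.fst ⊗ₘ κ) = ∫ x, Real.exp (Λ x) ∂L.fst := by
    have hint : Integrable (fun p : α × β => Real.exp (ψ p)) (L.fst ⊗ₘ κ) :=
      Integrable.of_bound hem.aestronglyMeasurable (Real.exp C) (ae_of_all _ fun p => by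
        rw [Real.norm_eq_abs, abs_of_pos (Real.exp_pos _)]
        exact (heb p).2)
    rw [Measure.integral_compProd hint]
    refine integral_congr_ae (ae_of_all _ fun x => ?_)
    simp only [hΛ]
    rw [Real.exp_log (hIpos x)]
  rw [hprod]
  linarith

/-- **The integrated fibre entropy is paid by the conditional Donsker–Varadhan budget.** For a
probability law `L` on `α × Ω` (`Ω` standard Borel) with disintegration
`L = L.fst ⊗ₘ L.condKernel` and a Markov kernel `κ : α → Ω`:
`∫⁻ x, KL(L.condKernel x ‖ κ x) L.fst(dx) ≤ KL(L ‖ L.fst ⊗ₘ κ)`. [folklore] -/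
theorem mel_lintegral_klDiv_condKernel_le {α Ω : Type*} [MeasurableSpace α] [MeasurableSpace Ω]
    [StandardBorelSpace Ω] [Nonempty Ω] (L : Measure (α × Ω)) [IsFiniteMeasure L]
    (κ : Kernel α Ω) [IsFiniteKernel κ] :
    ∫⁻ x, klDiv (L.condKernel x) (κ x) ∂L.fst ≤ klDiv L (L.fst ⊗ₘ κ) := by
  have h := mel_lintegral_klDiv_le_klDiv_compProd L.fst L.condKernel κ
  rwa [L.disintegrate L.condKernel] at h

/-- **Registered helper stub `stub_marginalEntropyLedger_prelim`** (helper file of S3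
`stub_marginalEntropyLedger`, line `local-gibbs-entropy-ledger`, crux
stmt-AtomisticToContinuum-14662): **conditional Donsker–Varadhan bound for the fibre entropy on
`𝕋³ × ℝ³`.** For a probability law `L` on `𝕋³ × ℝ³` with fibres `L(·|x) = L.condKernel x` and a
Markov kernel `κ` of reference velocity laws: if `∫ g dL ≤ K` for every bounded measurable `g`
with `∫ e^{g(x,·)} d(κ x) = 1` at every `x`, then `∫ KL(L(·|x) ‖ κ x) L.fst(dx) ≤ K` in `ℝ≥0∞`
(kernel Donsker–Varadhan `KL(L ‖ L.fst ⊗ₘ κ) ≤ K`, then the conditional chain-rule inequality for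
`L = L.fst ⊗ₘ L.condKernel`). [folklore] -/
theorem stub_marginalEntropyLedger_prelim :
    ∀ (L : Measure (T3 × V3)) [IsProbabilityMeasure L] (κ : Kernel T3 V3) [IsMarkovKernel κ]
      (K : ℝ), (∀ (g : T3 × V3 → ℝ) (C : ℝ), Measurable g → (∀ p, |g p| ≤ C) →
        (∀ x, ∫ v, Real.exp (g (x, v)) ∂(κ x) = 1) → ∫ p, g p ∂L ≤ K) →
      ∫⁻ x, klDiv (L.condKernel x) (κ x) ∂L.fst ≤ ENNReal.ofReal K := by
  intro L _ κ _ K h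
  exact (mel_lintegral_klDiv_condKernel_le L κ).trans (mel_klDiv_compProd_le_of_forall κ h)

end Summit.AtomisticToContinuum.HydrodynamicLimit.Theorems.KineticCurrentsWindowLDUniformLocalGibbs

end
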